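import Summits.CriticalPhenomena.PercolationContinuityZ3.Theorems.PercGamblersRuinBGNOffTheFloorThreshold
import HarnessLib

/-!
# WITNESS file for the profile ladder on `BGNOffTheFloor` (stmt-CriticalPhenomena-7773), forward generator G4

The rung family `ProfileBGN 𝒢 := ∀ g ∈ 𝒢, climb (g L) L → 0` at the FLOOR parameter `𝒢 = constProfiles`
(fixed depth) is PROVED here, sorry-free: `profileBGN_constProfiles` — Barsky–Grimmett–Newman "no percolation in
the half-space at `p_c(ℤ³)`" at every fixed depth, in the climb language of the crux (continuity from above along the
decreasing reach events, whose intersection is a.s. inside `{0 ⟷ ∞ in {z | -A < z₀}}`, a null event by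
`FreeBoxSparse.StubCeiling.real_percolatesVia_halfSpace_depth` ← `BarskyGrimmettNewman1991_Z3_holds`,
Grimmett 1999 Thm (7.35)).  The NEXT rung `SublinearProfileBGN = ProfileBGN sublinearProfiles` is the open stub of
`Lines/SublinearProfileBGN.lean`; definitions below are verbatim copies (separate namespace so both files coexist).
-/

noncomputable section

namespace Summit.CriticalPhenomena.PercolationContinuityZ3.Cruxes.BGNOffTheFloor.ProfileLadderWitness

open MeasureTheory Filter Asymptotics Literature.Probability.Percolation Literature.Probability.LatticeModels
open Summit.CriticalPhenomena.PercolationContinuityZ3.Theorems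
open scoped Topology

/-! ### The climb language of the crux -/

/-- The climb event `E(A, L)`: the origin is joined inside `{z | -A < z₀}` to a site of height `L`
(verbatim the event of `Theses.PercGamblersRuin.BGNOffTheFloor` at `A = a n`, `L = b n`). -/
def climbEvt (A L : ℕ) : Set (BondConfig (Site 3)) :=
  {ω | ∃ y : Site 3, y 0 = (L : ℤ) ∧ ω ∈ openConnIn {z : Site 3 | -(A : ℤ) < z 0} 0 y}

/-- The climb probability `climb A L = P_{p_c(ℤ³)}(E(A, L))`. -/
def climb (A L : ℕ) : ℝ :=
  (bondPercolation (zdGraph 3) (criticalProbI 3)).real (climbEvt A L)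

/-- The PROFILE family: Barsky–Grimmett–Newman with a floor receding along the depth profiles of
`𝒢` — for every `g ∈ 𝒢`, `climb (g L) L → 0` as `L → ∞`. Antitone in `𝒢`. -/
def ProfileBGN (𝒢 : Set (ℕ → ℕ)) : Prop :=
  ∀ g ∈ 𝒢, Tendsto (fun L : ℕ => climb (g L) L) atTop (𝓝 0)

/-- Constant profiles (fixed depth): the PROVED floor of the ladder (BGN). -/
def constProfiles : Set (ℕ → ℕ) := Set.range fun A : ℕ => fun _ : ℕ => A

/-- Sublinear profiles `g(L) = o(L)`: the NEXT RUNG. -/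
def sublinearProfiles : Set (ℕ → ℕ) :=
  {g | (fun L : ℕ => (g L : ℝ)) =o[atTop] fun L : ℕ => (L : ℝ)}

/-- **RUNG (crux #1 of the line).** `SublinearProfileBGN`: at `p_c(ℤ³)`, for every depth profile
`g = o(L)`, the probability of climbing to height `L` from depth `g(L)` above a floor, inside the
region above the floor, tends to `0`.  Equivalent (given BGN and the two monotonicities
`OffFloor.climb_real_mono`) to UNIFORM BGN: `sup_{n ≥ 1} climb n (b n) → 0` as `b → ∞`. -/
def SublinearProfileBGN : Prop := ProfileBGN sublinearProfiles


/-! ### The floor: BGN at every fixed depth (WITNESS, F3/BC5) -/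

/-- For the depth `A = 0` the climb event is empty (the origin is not in `{z | 0 < z₀}`). -/
theorem climbEvt_zero_left (L : ℕ) : climbEvt 0 L = ∅ := by
  ext ω
  simp only [climbEvt, Set.mem_setOf_eq, Set.mem_empty_iff_false, iff_false, openConnIn]
  rintro ⟨y, -, hx, -, -⟩
  simp at hx

/-- **BGN at fixed depth, climb form**: for every `A`, `climb A L → 0` as `L → ∞`.
Continuity from above along the decreasing events `{0 ⟷ height ≥ L in R(A)}`, whose intersection
is a.s. contained in `{0 ⟷ ∞ in R(A)}`, an event of probability `0` at `p_c`
(`StubCeiling.real_percolatesVia_halfSpace_depth`, Barsky–Grimmett–Newman, Grimmett 1999 Thm (7.35)). -/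
theorem tendsto_climb_const (A : ℕ) : Tendsto (fun L : ℕ => climb A L) atTop (𝓝 0) := by
  rcases Nat.eq_zero_or_pos A with rfl | hA
  · have h0 : (fun L : ℕ => climb 0 L) = fun _ => 0 := by
      funext L
      simp only [climb, climbEvt_zero_left, measureReal_empty]
    rw [h0]
    exact tendsto_const_nhds
  · set S : Set (Site 3) := {z : Site 3 | -(A : ℤ) < z 0} with hS
    set μ : Measure (BondConfig (Site 3)) := bondPercolation (zdGraph 3) (criticalProbI 3) with hμ
    -- the decreasing `reach` events
    set R : ℕ → Set (BondConfig (Site 3)) :=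
      fun n => {ω | ∃ y : Site 3, (n : ℤ) ≤ y 0 ∧ ω ∈ openConnIn S 0 y} with hR
    have hRmeas : ∀ n, MeasurableSet (R n) := by
      intro n
      have hset : R n = ⋃ y ∈ {y : Site 3 | (n : ℤ) ≤ y 0}, openConnIn S 0 y := by
        ext ω
        simp only [hR, Set.mem_setOf_eq, Set.mem_iUnion, exists_prop]
      rw [hset]
      exact MeasurableSet.biUnion (Set.to_countable _) fun y _ =>
        measurableSet_openConnIn_of_countable _ _ _
    have hRanti : Antitone R := by
      intro m n hmn ω hω
      obtain ⟨y, hy, hc⟩ := hω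
      exact ⟨y, le_trans (by exact_mod_cast hmn) hy, hc⟩
    have h0S : (0 : Site 3) ∈ S := by
      simp only [hS, Set.mem_setOf_eq, Pi.zero_apply]; omega
    -- no percolation in `R(A)` at `p_c` (BGN at depth `A`)
    have hperc : μ (percolatesVia (withinGraph (zdGraph 3) S) 0) = 0 := by
      have hSeq : S = {y : Site 3 | -(A : ℤ) + 1 ≤ y 0} := by
        ext z; simp only [hS, Set.mem_setOf_eq]; omega
      have hreal := FreeBoxSparse.StubCeiling.real_percolatesVia_halfSpace_depth (-(A : ℤ) + 1) 0
        (by rw [Pi.zero_apply]; omega)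
      rw [hSeq, ← measureReal_eq_zero_iff (measure_ne_top _ _)]
      exact hreal
    -- the intersection of the reach events is a.s. inside the percolation event
    have hle : μ (⋂ n, R n) ≤ μ (percolatesVia (withinGraph (zdGraph 3) S) 0) := by
      refine measure_mono_ae ?_
      filter_upwards [(ProbabilityTheory.setBernoulli_ae_subset :
        ∀ᵐ ω ∂μ, ω ⊆ (zdGraph 3).edgeSet)] with ω hω hmem
      refine FreeBoxSparse.StubCeiling.percolatesVia_of_infinite h0S hω ?_
      have hmem' : ∀ n : ℕ, ω ∈ R n := fun n => Set.mem_iInter.1 hmem n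
      by_contra hfin
      rw [Set.not_infinite] at hfin
      obtain ⟨M, hM⟩ := (hfin.image fun y : Site 3 => y 0).bddAbove
      obtain ⟨y, hyn, hy⟩ := hmem' (M.toNat + 1)
      have h1 : y 0 ≤ M := hM (Set.mem_image_of_mem _ hy)
      have h2 : M < ((M.toNat + 1 : ℕ) : ℤ) := by push_cast; omega
      omega
    have hnull : μ (⋂ n, R n) = 0 := nonpos_iff_eq_zero.1 (hperc ▸ hle)
    have hlim := tendsto_measure_iInter_atTop (μ := μ)
      (fun n => (hRmeas n).nullMeasurableSet) hRanti ⟨0, measure_ne_top _ _⟩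
    rw [hnull] at hlim
    have hlim' : Tendsto (fun n => (μ (R n)).toReal) atTop (𝓝 0) := by
      have h := (ENNReal.tendsto_toReal ENNReal.zero_ne_top).comp hlim
      rw [ENNReal.toReal_zero] at h
      exact h
    refine squeeze_zero (fun n => measureReal_nonneg) (fun n => ?_) hlim'
    show μ.real (climbEvt A n) ≤ (μ (R n)).toReal
    rw [← measureReal_def]
    exact measureReal_mono (fun ω ⟨y, hy, hc⟩ => ⟨y, hy.symm.le, hc⟩) (measure_ne_top _ _)

/-- **WITNESS (F3 / BC5): the rung family at the floor parameter is PROVED** — `ProfileBGN`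
holds for the constant profiles (Barsky–Grimmett–Newman at every fixed depth). -/
theorem profileBGN_constProfiles : ProfileBGN constProfiles := by
  rintro g ⟨A, rfl⟩
  exact tendsto_climb_const A

example : ProfileBGN constProfiles := profileBGN_constProfiles

/-- The rung stated (NOT proved here): kept so the witness file names what it is the floor of. -/
example : Prop := SublinearProfileBGN

end Summit.CriticalPhenomena.PercolationContinuityZ3.Cruxes.BGNOffTheFloor.ProfileLadderWitness
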